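import Mathlib

/-!
# Route OverlapGapAlgebra, crux `SearchHardWindow` (stmt-PneNP-2460), line `Sketch`: the parameter
# asymptotics of Huang–Sellke 2025 §3.3.2

Stub `stub_hsAsymptotics` of the skeleton
`Summits/PneNP/PneNP/Cruxes/SearchHardWindow/Lines/Sketch.lean` (section `HS25`): the pure
real-analysis bookkeeping of the parameters in the proof of Huang–Sellke 2025 (arXiv:2501.06427)
Cor. 3.21 (§3.3.2, p. 23), as consumed verbatim by the lead's assembly `stub_hsAssembly`.

With a degree sequence `1 ≤ D n = o(n)` put `x_n := D n / n → 0⁺`, `y_n := n / D n → ∞`, the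
resampling rate `ε_n := log(n / D n) / n`, the instability level
`u_n := 2 ε_n (1 + ε_n ⌊α n⌋ k) · D n · C / θ`, the gap `W_n := ⌈1 / (b k ε_n)⌉` and the chain length
`T_n := k W_n`. Then eventually in `n`:

1. `D n < n` (as `x_n → 0`);
2. `ε_n > 0` (as `n / D n > 1`);
3. `u_n ≤ p² / 2`: `ε_n D n = log(y_n) / y_n` and `ε_n ⌊α n⌋ k ≤ α k log(y_n)`, so
   `u_n ≤ (2C/θ) (log y_n / y_n + α k log² y_n / y_n) → 0` (`Real.isLittleO_log_id_atTop`,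
   `Real.isLittleO_pow_log_id_atTop` along `y_n → ∞`);
4. `T_n ≤ n²`: `T_n ≤ k (1/(b k ε_n) + 1) = n / (b log y_n) + k ≤ n + k ≤ n²` once
   `b log y_n ≥ 1` and `n ≥ k + 1`;
5. `2 e^{-c n} < (p²/2)^{2 T_n}`: taking logarithms, with `A := |log (p²/2)|` it suffices that
   `2 A T_n + log 2 < c n`, which follows from `T_n ≤ n / (b log y_n) + k`, `1 / (b log y_n) → 0`
   and `n → ∞`.
-/

set_option linter.dupNamespace false -- `Summit.PneNP.PneNP.…`: summit = sub-problem

namespace Summit.PneNP.PneNP.Theorems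

open Finset Filter Asymptotics Topology

/-- `n / D n → ∞` for a positive sequence `D = o(n)` of naturals. -/
theorem hsa_tendsto_div_atTop (D : ℕ → ℕ)
    (hD : (fun n : ℕ => (D n : ℝ)) =o[atTop] (fun n : ℕ => (n : ℝ))) (hD1 : ∀ n, 1 ≤ D n) :
    Tendsto (fun n : ℕ => (n : ℝ) / D n) atTop atTop := by
  have hx : Tendsto (fun n : ℕ => (D n : ℝ) / n) atTop (𝓝 0) := hD.tendsto_div_nhds_zero
  have hx' : Tendsto (fun n : ℕ => (D n : ℝ) / n) atTop (𝓝[>] 0) := by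
    refine tendsto_nhdsWithin_iff.2 ⟨hx, ?_⟩
    filter_upwards [eventually_gt_atTop 0] with n hn
    have h1 : (0 : ℝ) < D n := Nat.cast_pos.2 (hD1 n)
    have h2 : (0 : ℝ) < n := Nat.cast_pos.2 hn
    exact div_pos h1 h2
  exact hx'.inv_tendsto_nhdsGT_zero.congr fun n => by simp [inv_div]

/-- The majorant of the instability level tends to `0`:
`(2C/θ) (log y_n / y_n + α k log² y_n / y_n) → 0` along `y_n = n / D n → ∞`. -/
theorem hsa_tendsto_majorant (D : ℕ → ℕ) (α C θ : ℝ) (k : ℕ)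
    (hy : Tendsto (fun n : ℕ => (n : ℝ) / D n) atTop atTop) :
    Tendsto (fun n : ℕ => 2 * C / θ * (Real.log ((n : ℝ) / D n) / ((n : ℝ) / D n) +
      α * k * (Real.log ((n : ℝ) / D n) ^ 2 / ((n : ℝ) / D n)))) atTop (𝓝 0) := by
  have h1 : Tendsto (fun n : ℕ => Real.log ((n : ℝ) / D n) / ((n : ℝ) / D n)) atTop (𝓝 0) := by
    have := Real.isLittleO_log_id_atTop.tendsto_div_nhds_zero.comp hy
    simpa [Function.comp_def] using this
  have h2 : Tendsto (fun n : ℕ => Real.log ((n : ℝ) / D n) ^ 2 / ((n : ℝ) / D n)) atTop (𝓝 0) := by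
    have := (Real.isLittleO_pow_log_id_atTop (n := 2)).tendsto_div_nhds_zero.comp hy
    simpa [Function.comp_def] using this
  have := (h1.add (h2.const_mul (α * k))).const_mul (2 * C / θ)
  simpa using this

/-- **The parameter asymptotics of HS25 §3.3.2** (Huang–Sellke 2025, arXiv:2501.06427, proof of
Cor. 3.21; real analysis only): with `ε_n = log(n / D n)/n` for `1 ≤ D = o(n)`, eventually
`D n < n`, `ε_n > 0`, the instability level `2ε_n(1 + ε_n ⌊αn⌋ k) D n · C/θ ≤ p²/2`, the chain
length `T_n = k ⌈1/(b k ε_n)⌉ ≤ n²`, and `2 e^{−cn} < (p²/2)^{2 T_n}` (because `T_n = o(n)` as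
`log(n/D n) → ∞`). -/
theorem stub_hsAsymptotics (k : ℕ) (hk : 1 ≤ k) (α b c C θ p : ℝ) (hα : 0 < α) (hb : 0 < b)
    (hc : 0 < c) (hC : 0 < C) (hθ : 0 < θ) (hp : 0 < p) (D : ℕ → ℕ)
    (hD : (fun n : ℕ => (D n : ℝ)) =o[atTop] (fun n : ℕ => (n : ℝ))) (hD1 : ∀ n, 1 ≤ D n) :
    ∀ᶠ n : ℕ in atTop, (D n : ℝ) < n ∧ 0 < Real.log (n / D n) / n ∧
      2 * (Real.log (n / D n) / n) * (1 + Real.log (n / D n) / n * (⌊α * n⌋₊ * k)) * D n * C / θ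
        ≤ p ^ 2 / 2 ∧
      k * ⌈1 / (b * k * (Real.log (n / D n) / n))⌉₊ ≤ n ^ 2 ∧
      2 * Real.exp (-(c * n)) <
        (p ^ 2 / 2) ^ (2 * (k * ⌈1 / (b * k * (Real.log (n / D n) / n))⌉₊)) := by
  have _hα := hα
  have _hC := hC
  have hk0 : (0 : ℝ) < k := Nat.cast_pos.2 hk
  have hq : 0 < p ^ 2 / 2 := by positivity
  -- `A := |log (p²/2)|`
  obtain ⟨A, hA0, hAq⟩ : ∃ A : ℝ, 0 ≤ A ∧ -A ≤ Real.log (p ^ 2 / 2) :=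
    ⟨|Real.log (p ^ 2 / 2)|, abs_nonneg _, neg_abs_le _⟩
  -- the basic limits
  have hx : Tendsto (fun n : ℕ => (D n : ℝ) / n) atTop (𝓝 0) := hD.tendsto_div_nhds_zero
  have hy : Tendsto (fun n : ℕ => (n : ℝ) / D n) atTop atTop := hsa_tendsto_div_atTop D hD hD1
  have hlog : Tendsto (fun n : ℕ => Real.log ((n : ℝ) / D n)) atTop atTop :=
    Real.tendsto_log_atTop.comp hy
  have hM := hsa_tendsto_majorant D α C θ k hy
  have hinv : Tendsto (fun n : ℕ => 1 / (b * Real.log ((n : ℝ) / D n))) atTop (𝓝 0) :=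
    tendsto_const_nhds.div_atTop (hlog.const_mul_atTop hb)
  have hinvA : Tendsto (fun n : ℕ => 2 * A * (1 / (b * Real.log ((n : ℝ) / D n)))) atTop (𝓝 0) := by
    simpa using hinv.const_mul (2 * A)
  have hlin : Tendsto (fun n : ℕ => c / 2 * (n : ℝ)) atTop atTop :=
    tendsto_natCast_atTop_atTop.const_mul_atTop (by positivity)
  -- the eventual facts
  have e1 : ∀ᶠ n : ℕ in atTop, (D n : ℝ) / n < 1 := (tendsto_order.1 hx).2 1 one_pos
  have e3 : ∀ᶠ n : ℕ in atTop, 2 * C / θ * (Real.log ((n : ℝ) / D n) / ((n : ℝ) / D n) +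
      α * k * (Real.log ((n : ℝ) / D n) ^ 2 / ((n : ℝ) / D n))) < p ^ 2 / 2 :=
    (tendsto_order.1 hM).2 _ hq
  have e4 : ∀ᶠ n : ℕ in atTop, 1 / (b * Real.log ((n : ℝ) / D n)) < 1 :=
    (tendsto_order.1 hinv).2 1 one_pos
  have e5 : ∀ᶠ n : ℕ in atTop, 2 * A * (1 / (b * Real.log ((n : ℝ) / D n))) < c / 2 :=
    (tendsto_order.1 hinvA).2 _ (by positivity)
  have e6 : ∀ᶠ n : ℕ in atTop, 2 * A * k + Real.log 2 < c / 2 * (n : ℝ) :=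
    hlin.eventually_gt_atTop _
  filter_upwards [eventually_gt_atTop 0, e1, e3, e4, e5, e6, eventually_ge_atTop (k + 1)] with n hn0
    h1n h3n h4n h5n h6n h7n
  set L := Real.log ((n : ℝ) / D n) with hL_def
  have hn : (0 : ℝ) < n := Nat.cast_pos.2 hn0
  have hDn : (0 : ℝ) < D n := Nat.cast_pos.2 (hD1 n)
  have hlt : (D n : ℝ) < n := (div_lt_one hn).1 h1n
  have hy1 : 1 < (n : ℝ) / D n := (one_lt_div hDn).2 hlt
  have hL : 0 < L := Real.log_pos hy1
  have hε : 0 < L / n := div_pos hL hn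
  have hk1 : (k : ℝ) + 1 ≤ n := by exact_mod_cast h7n
  -- the chain length `T_n = k ⌈1/(b k ε_n)⌉ ≤ n / (b log y_n) + k`
  have hr : 0 ≤ 1 / (b * k * (L / n)) := by positivity
  have hceil : (⌈1 / (b * k * (L / n))⌉₊ : ℝ) < 1 / (b * k * (L / n)) + 1 := Nat.ceil_lt_add_one hr
  have hT : (k : ℝ) * ⌈1 / (b * k * (L / n))⌉₊ ≤ n * (1 / (b * L)) + k := by
    calc (k : ℝ) * ⌈1 / (b * k * (L / n))⌉₊ ≤ k * (1 / (b * k * (L / n)) + 1) := by gcongr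
      _ = n * (1 / (b * L)) + k := by
        field_simp
  refine ⟨hlt, hε, ?_, ?_, ?_⟩
  · -- the instability level
    have hfl : (⌊α * (n : ℝ)⌋₊ : ℝ) ≤ α * n := Nat.floor_le (by positivity)
    calc 2 * (L / n) * (1 + L / n * (⌊α * (n : ℝ)⌋₊ * k)) * D n * C / θ
        ≤ 2 * (L / n) * (1 + L / n * (α * n * k)) * D n * C / θ := by gcongr
      _ = 2 * C / θ * (L / ((n : ℝ) / D n) + α * k * (L ^ 2 / ((n : ℝ) / D n))) := by
        field_simp
      _ ≤ p ^ 2 / 2 := h3n.le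
  · -- `T_n ≤ n²`
    have h' : (n : ℝ) * (1 / (b * L)) + k ≤ (n : ℝ) ^ 2 := by
      nlinarith [mul_nonneg hn.le (sub_nonneg.2 h4n.le), mul_nonneg hn.le (sub_nonneg.2 hk1),
        mul_nonneg hk0.le (show (0 : ℝ) ≤ n - 1 by linarith)]
    exact_mod_cast hT.trans h'
  · -- `2 e^{-cn} < (p²/2)^{2 T_n}`
    have hmain : 2 * A * ((k : ℝ) * ⌈1 / (b * k * (L / n))⌉₊) + Real.log 2 < c * n := by
      have i1 := mul_le_mul_of_nonneg_left hT (by positivity : (0 : ℝ) ≤ 2 * A)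
      have i2 := mul_le_mul_of_nonneg_right h5n.le hn.le
      nlinarith [i1, i2, h6n]
    rw [← Real.log_lt_log_iff (by positivity) (by positivity),
      Real.log_mul two_ne_zero (Real.exp_pos _).ne', Real.log_exp, Real.log_pow]
    push_cast
    have i3 : 2 * ((k : ℝ) * ⌈1 / (b * k * (L / n))⌉₊) * -A ≤
        2 * ((k : ℝ) * ⌈1 / (b * k * (L / n))⌉₊) * Real.log (p ^ 2 / 2) :=
      mul_le_mul_of_nonneg_left hAq (by positivity)
    linarith [hmain, i3]

end Summit.PneNP.PneNP.Theorems
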